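import Mathlib
import Summits.NavierStokesRegularity.NavierStokesRegularity.Theorems.SymmetryModuliCountStretchingCertificateComparisonKato
import Literature.Analysis.FluidPDE.TypeIAncientMildClassical
import Literature.Analysis.FluidPDE.ParabolicComparison
import HarnessLib

/-!
# The weighted Kato quotient of a certified field: pointwise subsolution and Type-I bound
(route `SymmetryModuliCount`, item stmt-NavierStokesRegularity-14340 `StretchingCertificateComparison`,
helper file)

For `u` in the Type-I ancient mild class `A_C` (`IsTypeIAncientMild C u`) and a stretching
certificate `(δ, A, h)` — `h ≥ 1` jointly smooth on `t < 0`, `‖∇h‖ ≤ A(1/√(−t) + |x|/(−t)) h`,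
and wherever `ω = curl u ≠ 0`
`((−t)(⟪∇u ξ, ξ⟫ − |∇ξ|²_F) − 1 + δ) h ≤ (−t)(∂ₜh + u·∇h − Δh)` — the WEIGHTED quotient
`P = (−t)^{2−2δ} |ω|²/h²` is the object the comparison argument runs on:

* `stretchCert_P_pointwise_of_ne`: at a point with `ω ≠ 0`, `∂ₜP + u·∇P − ΔP ≤ 2h⁻¹ Σᵢ ∂ᵢP ∂ᵢh`
  (the tree's `stretchCert_F_subsolution` for `F = |ω|²/h²` times the weight, whose time
  derivative cancels the zeroth-order term `2(1−δ)F/(−t)` exactly);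
* `stretchCert_P_subsolution`: at EVERY point of `t < 0`,
  `∂ₜP ≤ ΔP + (C/√(−t) + 6|A|(1/√(−t) + |x|/(−t))) ‖∇P‖` (at a zero of `ω` the smooth
  nonnegative `P` has a space–time minimum);
* `stretchCert_P_le`: `P ≤ (κK₀)²(−t)^{−2δ}` from a gauge gradient bound `(−t)‖∇u‖ ≤ K₀` and
  `|ω| ≤ κ‖∇u‖`, `κ = ‖curlCLM‖`.

The maximum-principle step and the conclusion `u ≡ 0` are in
`SymmetryModuliCountStretchingCertificateComparison.lean`.

## References

* P. Constantin, Comm. Math. Phys. 129 (1990) 241–266, (2.9). [Constantin1990]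
* P. Constantin, C. Fefferman, Indiana Univ. Math. J. 42 (1993) 775–789, §1. [ConstantinFefferman1993]
-/

noncomputable section

-- the summit and its single sub-problem share the name (CONVENTIONS §1), as in every Theorems file
set_option linter.dupNamespace false

open Set Function Filter
open scoped RealInnerProductSpace Laplacian ContDiff Topology

namespace Summit.NavierStokesRegularity.NavierStokesRegularity.Theorems

open Literature.Analysis Literature.Analysis.FluidPDE

/-- The quotient `F(t, x) = |curl u(t)(x)|² / h(t, x)²` of the squared vorticity of a jointly
smooth field by the square of a jointly smooth weight `h ≥ 1` is jointly smooth on `t < 0`.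
[folklore] -/
theorem isSmoothSpaceTimeOn_stretchCert_F
    {u : ℝ → EuclideanSpace ℝ (Fin 3) → EuclideanSpace ℝ (Fin 3)}
    {h : ℝ → EuclideanSpace ℝ (Fin 3) → ℝ}
    (hsm : IsSmoothSpaceTimeOn (Iio 0) u) (hh : IsSmoothSpaceTimeOn (Iio 0) h)
    (hh1 : ∀ t < 0, ∀ y, 1 ≤ h t y) :
    IsSmoothSpaceTimeOn (Iio 0) fun s y => ‖curl (u s) y‖ ^ 2 / h s y ^ 2 := by
  have hvort : IsSmoothSpaceTimeOn (Iio 0) (vorticity u) := isSmoothSpaceTimeOn_vorticity_Iio hsm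
  have h1 : ContDiffOn ℝ ∞ (fun p : ℝ × EuclideanSpace ℝ (Fin 3) => ‖uncurry (vorticity u) p‖ ^ 2)
      (Iio 0 ×ˢ univ) := hvort.norm_sq ℝ
  have h2 : ContDiffOn ℝ ∞ (fun p : ℝ × EuclideanSpace ℝ (Fin 3) => (uncurry h p) ^ 2)
      (Iio 0 ×ˢ univ) := hh.pow 2
  have h3 := h1.div h2 (by
    rintro ⟨t, y⟩ ⟨ht, -⟩
    exact pow_ne_zero 2 (lt_of_lt_of_le one_pos (hh1 t ht y)).ne')
  refine h3.congr ?_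
  rintro ⟨t, y⟩ -
  rfl

/-- The weighted quotient `P(t, x) = (−t)^γ |curl u(t)(x)|² / h(t, x)²` is jointly smooth on
`t < 0` (`(−t)^γ` is smooth for `−t > 0`). [folklore] -/
theorem isSmoothSpaceTimeOn_stretchCert_P
    {u : ℝ → EuclideanSpace ℝ (Fin 3) → EuclideanSpace ℝ (Fin 3)}
    {h : ℝ → EuclideanSpace ℝ (Fin 3) → ℝ}
    (hsm : IsSmoothSpaceTimeOn (Iio 0) u) (hh : IsSmoothSpaceTimeOn (Iio 0) h)
    (hh1 : ∀ t < 0, ∀ y, 1 ≤ h t y) (γ : ℝ) :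
    IsSmoothSpaceTimeOn (Iio 0) fun s y => (-s) ^ γ * (‖curl (u s) y‖ ^ 2 / h s y ^ 2) := by
  have hF := isSmoothSpaceTimeOn_stretchCert_F hsm hh hh1
  have hw : ContDiffOn ℝ ∞ (fun p : ℝ × EuclideanSpace ℝ (Fin 3) => (-p.1) ^ γ) (Iio 0 ×ˢ univ) := by
    rintro ⟨t, y⟩ ⟨ht, -⟩
    have ht' : (-t : ℝ) ≠ 0 := (neg_pos.2 (mem_Iio.1 ht)).ne'
    exact ((contDiffAt_fst.neg).rpow_const_of_ne ht').contDiffWithinAt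
  have h3 := hw.mul hF
  refine h3.congr ?_
  rintro ⟨t, y⟩ -
  rfl

/-- **Kato's inequality with a stretching certificate, weighted form, at a point with `ω ≠ 0`.**
For a jointly smooth `u` on `t < 0` whose vorticity satisfies the vorticity equation at `(t, x)`,
a jointly smooth `h ≥ 1`, and the certificate inequality at `(t, x)`, the weighted quotient
`P = (−t)^{2−2δ}|ω|²/h²` satisfies `∂ₜP + u·∇P − ΔP ≤ 2h⁻¹ Σᵢ ∂ᵢP ∂ᵢh` at `(t, x)`: the tree's
`stretchCert_F_subsolution` (`∂ₜF + u·∇F − ΔF ≤ 2(1−δ)F/(−t) + 2h⁻¹∇F·∇h` for `F = |ω|²/h²`)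
multiplied by `(−t)^{2−2δ}`, whose time derivative `−(2−2δ)(−t)^{1−2δ}F` cancels the
zeroth-order term. [cite: Constantin1990, (2.9)] -/
theorem stretchCert_P_pointwise_of_ne
    {u : ℝ → EuclideanSpace ℝ (Fin 3) → EuclideanSpace ℝ (Fin 3)}
    {h : ℝ → EuclideanSpace ℝ (Fin 3) → ℝ}
    (hsm : IsSmoothSpaceTimeOn (Iio 0) u) (hh : IsSmoothSpaceTimeOn (Iio 0) h)
    (hh1 : ∀ t < 0, ∀ y, 1 ≤ h t y) {δ t : ℝ} (ht : t < 0) {x : EuclideanSpace ℝ (Fin 3)}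
    (hω : curl (u t) x ≠ 0)
    (hveq : deriv (fun s => curl (u s) x) t + fderiv ℝ (curl (u t)) x (u t x) =
      fderiv ℝ (u t) x (curl (u t) x) + (Δ (curl (u t))) x)
    (hcert : ((-t) * (⟪fderiv ℝ (u t) x (vorticityDirection (curl (u t)) x),
        vorticityDirection (curl (u t)) x⟫
        - frobeniusNormSq (fderiv ℝ (vorticityDirection (curl (u t))) x)) - 1 + δ) * h t x ≤
      (-t) * (timeDeriv h t x + fderiv ℝ (h t) x (u t x) - (Δ (h t)) x)) :
    deriv (fun s => (-s) ^ (2 - 2 * δ) * (‖curl (u s) x‖ ^ 2 / h s x ^ 2)) t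
        + fderiv ℝ (fun y => (-t) ^ (2 - 2 * δ) * (‖curl (u t) y‖ ^ 2 / h t y ^ 2)) x (u t x)
        - (Δ fun y => (-t) ^ (2 - 2 * δ) * (‖curl (u t) y‖ ^ 2 / h t y ^ 2)) x ≤
      2 * (h t x)⁻¹ * ∑ i, fderiv ℝ (fun y => (-t) ^ (2 - 2 * δ) * (‖curl (u t) y‖ ^ 2 / h t y ^ 2)) x
            (stdOrthonormalBasis ℝ (EuclideanSpace ℝ (Fin 3)) i)
          * fderiv ℝ (h t) x (stdOrthonormalBasis ℝ (EuclideanSpace ℝ (Fin 3)) i) := by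
  have key := stretchCert_F_subsolution hsm hh hh1 (δ := δ) ht hω hveq hcert
  set b := stdOrthonormalBasis ℝ (EuclideanSpace ℝ (Fin 3)) with hb
  set F : ℝ → EuclideanSpace ℝ (Fin 3) → ℝ := fun s y => ‖curl (u s) y‖ ^ 2 / h s y ^ 2 with hFdef
  set γ : ℝ := 2 - 2 * δ with hγ
  set c : ℝ := (-t) ^ γ with hc
  have ht0 : 0 < -t := neg_pos.2 ht
  have ht' : t ∈ Iio (0 : ℝ) := ht
  have hc0 : 0 < c := Real.rpow_pos_of_pos ht0 γ
  -- the inequality for `F`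
  have key' : deriv (fun s => F s x) t + fderiv ℝ (F t) x (u t x) - (Δ (F t)) x ≤
      2 * (1 - δ) / (-t) * F t x + 2 * (h t x)⁻¹ * ∑ i, fderiv ℝ (F t) x (b i) * fderiv ℝ (h t) x (b i) :=
    key
  -- smoothness of `F`
  have hFsm : IsSmoothSpaceTimeOn (Iio 0) F := isSmoothSpaceTimeOn_stretchCert_F hsm hh hh1
  have hF2 : ContDiff ℝ 2 (F t) := (hFsm.contDiff_slice ht').of_le (by norm_cast)
  have hFd : DifferentiableAt ℝ (F t) x := (hF2.differentiable two_ne_zero) x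
  -- spatial derivatives of the slice `P t = c • F t`
  have hPt_eq : (fun y => c * F t y) = c • F t := rfl
  have hDP : ∀ w, fderiv ℝ (fun y => c * F t y) x w = c * fderiv ℝ (F t) x w := by
    intro w
    rw [fderiv_const_mul hFd]
    rfl
  have hΔP : (Δ fun y => c * F t y) x = c * (Δ (F t)) x := by
    rw [hPt_eq, InnerProductSpace.laplacian_smul c hF2.contDiffAt]
    rfl
  -- the time derivative of `s ↦ (-s)^γ F(s, x)`
  have hFt : HasDerivAt (fun s => F s x) (deriv (fun s => F s x) t) t :=
    hFsm.hasDerivAt_timeLine isOpen_Iio ht' x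
  have hw : HasDerivAt (fun s : ℝ => (-s) ^ γ) ((-1) * γ * (-t) ^ (γ - 1)) t :=
    (hasDerivAt_neg t).rpow_const (Or.inl ht0.ne')
  have hPt : HasDerivAt (fun s => (-s) ^ γ * F s x)
      ((-1) * γ * (-t) ^ (γ - 1) * F t x + (-t) ^ γ * deriv (fun s => F s x) t) t := hw.mul hFt
  show deriv (fun s => (-s) ^ γ * F s x) t + fderiv ℝ (fun y => c * F t y) x (u t x)
      - (Δ fun y => c * F t y) x ≤ 2 * (h t x)⁻¹ * ∑ i, fderiv ℝ (fun y => c * F t y) x (b i) * fderiv ℝ (h t) x (b i)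
  rw [hPt.deriv, hDP, hΔP]
  simp only [hDP]
  have hr : (-t) ^ (γ - 1) = c / (-t) := by rw [hc]; exact Real.rpow_sub_one ht0.ne' γ
  rw [hr, ← hc]
  have hsum : ∑ i, c * fderiv ℝ (F t) x (b i) * fderiv ℝ (h t) x (b i) =
      c * ∑ i, fderiv ℝ (F t) x (b i) * fderiv ℝ (h t) x (b i) := by
    rw [Finset.mul_sum]
    exact Finset.sum_congr rfl fun i _ => by ring
  rw [hsum]
  have k2 := mul_le_mul_of_nonneg_left key' hc0.le
  have e1 : c * (2 * (1 - δ) / (-t) * F t x) = γ * (c / (-t)) * F t x := by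
    rw [hγ]; ring
  nlinarith [k2, e1]

/-- **The weighted quotient is a subsolution of a drift–heat inequality with linearly growing
drift, at every point of `t < 0`.** For `u ∈ A_C` with a stretching certificate `(δ, A, h)`,
`P = (−t)^{2−2δ}|ω|²/h²` satisfies
`∂ₜP ≤ ΔP + (C/√(−t) + 6|A|(1/√(−t) + ‖x‖/(−t))) ‖∇P‖` everywhere: where `ω ≠ 0` this is
`stretchCert_P_pointwise_of_ne` with `|u·∇P| ≤ (C/√(−t))‖∇P‖` (Type-I bound) and
`|2h⁻¹Σᵢ∂ᵢP∂ᵢh| ≤ 6(‖∇h‖/h)‖∇P‖ ≤ 6|A|(1/√(−t) + ‖x‖/(−t))‖∇P‖`; where `ω = 0` the smooth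
nonnegative `P` has a space–time minimum, so `∂ₜP = 0`, `∇P = 0`, `ΔP ≥ 0`
(`IsLocalMax.laplacian_nonpos`). [folklore] -/
theorem stretchCert_P_subsolution
    {C : ℝ} {u : ℝ → EuclideanSpace ℝ (Fin 3) → EuclideanSpace ℝ (Fin 3)}
    (hu : IsTypeIAncientMild C u) {h : ℝ → EuclideanSpace ℝ (Fin 3) → ℝ}
    (hh : IsSmoothSpaceTimeOn (Iio 0) h) (hh1 : ∀ t < 0, ∀ y, 1 ≤ h t y) {δ A : ℝ}
    (hgrad : ∀ t < 0, ∀ y, ‖fderiv ℝ (h t) y‖ ≤ A * (1 / Real.sqrt (-t) + ‖y‖ / (-t)) * h t y)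
    (hcert : ∀ t < 0, ∀ y, curl (u t) y ≠ 0 →
      ((-t) * (⟪fderiv ℝ (u t) y (vorticityDirection (curl (u t)) y),
          vorticityDirection (curl (u t)) y⟫
          - frobeniusNormSq (fderiv ℝ (vorticityDirection (curl (u t))) y)) - 1 + δ) * h t y ≤
        (-t) * (timeDeriv h t y + fderiv ℝ (h t) y (u t y) - (Δ (h t)) y))
    {t : ℝ} (ht : t < 0) (x : EuclideanSpace ℝ (Fin 3)) :
    deriv (fun s => (-s) ^ (2 - 2 * δ) * (‖curl (u s) x‖ ^ 2 / h s x ^ 2)) t ≤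
      (Δ fun y => (-t) ^ (2 - 2 * δ) * (‖curl (u t) y‖ ^ 2 / h t y ^ 2)) x
        + (C / Real.sqrt (-t) + 6 * |A| * (1 / Real.sqrt (-t) + ‖x‖ / (-t)))
          * ‖fderiv ℝ (fun y => (-t) ^ (2 - 2 * δ) * (‖curl (u t) y‖ ^ 2 / h t y ^ 2)) x‖ := by
  have hsm : IsSmoothSpaceTimeOn (Iio 0) u := hu.contDiffOn
  have ht0 : 0 < -t := neg_pos.2 ht
  have ht' : t ∈ Iio (0 : ℝ) := ht
  set b := stdOrthonormalBasis ℝ (EuclideanSpace ℝ (Fin 3)) with hb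
  set γ : ℝ := 2 - 2 * δ with hγ
  set P : ℝ → EuclideanSpace ℝ (Fin 3) → ℝ :=
    fun s y => (-s) ^ γ * (‖curl (u s) y‖ ^ 2 / h s y ^ 2) with hPdef
  have hPsm : IsSmoothSpaceTimeOn (Iio 0) P := isSmoothSpaceTimeOn_stretchCert_P hsm hh hh1 γ
  have hP2 : ContDiff ℝ 2 (P t) := (hPsm.contDiff_slice ht').of_le (by norm_cast)
  have hw0 : 0 ≤ 1 / Real.sqrt (-t) + ‖x‖ / (-t) := by positivity
  show deriv (fun s => P s x) t ≤ (Δ (P t)) x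
      + (C / Real.sqrt (-t) + 6 * |A| * (1 / Real.sqrt (-t) + ‖x‖ / (-t))) * ‖fderiv ℝ (P t) x‖
  by_cases hω : curl (u t) x = 0
  · -- a zero of the vorticity is a space–time minimum of `P ≥ 0`
    have hP0 : P t x = 0 := by simp [hPdef, hω]
    have hPnn : ∀ s < (0 : ℝ), ∀ y, 0 ≤ P s y := fun s hs y =>
      mul_nonneg (Real.rpow_nonneg (neg_pos.2 hs).le _) (div_nonneg (sq_nonneg _) (sq_nonneg _))
    have hminx : IsLocalMin (P t) x :=
      Filter.Eventually.of_forall fun y => by rw [hP0]; exact hPnn t ht y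
    have hmint : IsLocalMin (fun s => P s x) t := by
      filter_upwards [Iio_mem_nhds ht] with s hs
      rw [hP0]
      exact hPnn s hs x
    have hD : fderiv ℝ (P t) x = 0 := hminx.fderiv_eq_zero
    have hdt : deriv (fun s => P s x) t = 0 := hmint.deriv_eq_zero
    have hΔ : 0 ≤ (Δ (P t)) x := by
      have h1 : (Δ (fun y => -P t y)) x ≤ 0 := IsLocalMax.laplacian_nonpos hP2.neg hminx.neg
      have e : (fun y => -P t y) = -(P t) := rfl
      rw [e, InnerProductSpace.laplacian_neg, Pi.neg_apply, neg_nonpos] at h1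
      exact h1
    rw [hdt, hD, norm_zero, mul_zero, add_zero]
    exact hΔ
  · -- Kato's inequality with the certificate
    have hveq := vorticity_eq_deriv_of_typeI hu ht x
    have key := stretchCert_P_pointwise_of_ne hsm hh hh1 (δ := δ) ht hω hveq (hcert t ht x hω)
    change deriv (fun s => P s x) t + fderiv ℝ (P t) x (u t x) - (Δ (P t)) x ≤
      2 * (h t x)⁻¹ * ∑ i, fderiv ℝ (P t) x (b i) * fderiv ℝ (h t) x (b i) at key
    have hhx : 0 < h t x := lt_of_lt_of_le one_pos (hh1 t ht x)
    -- the transport term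
    have h1 : -(fderiv ℝ (P t) x (u t x)) ≤ ‖fderiv ℝ (P t) x‖ * (C / Real.sqrt (-t)) := by
      have a1 : |fderiv ℝ (P t) x (u t x)| ≤ ‖fderiv ℝ (P t) x‖ * ‖u t x‖ := by
        rw [← Real.norm_eq_abs]; exact (fderiv ℝ (P t) x).le_opNorm (u t x)
      have a2 : ‖fderiv ℝ (P t) x‖ * ‖u t x‖ ≤ ‖fderiv ℝ (P t) x‖ * (C / Real.sqrt (-t)) :=
        mul_le_mul_of_nonneg_left (hu.norm_le ht x) (norm_nonneg _)
      linarith [neg_abs_le (fderiv ℝ (P t) x (u t x))]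
    -- the cross term
    have h2 : ∀ i, fderiv ℝ (P t) x (b i) * fderiv ℝ (h t) x (b i) ≤
        ‖fderiv ℝ (P t) x‖ * ‖fderiv ℝ (h t) x‖ := by
      intro i
      have hbi : ‖b i‖ = 1 := b.orthonormal.1 i
      have a1 : |fderiv ℝ (P t) x (b i)| ≤ ‖fderiv ℝ (P t) x‖ := by
        have := (fderiv ℝ (P t) x).le_opNorm (b i)
        rwa [hbi, mul_one, Real.norm_eq_abs] at this
      have a2 : |fderiv ℝ (h t) x (b i)| ≤ ‖fderiv ℝ (h t) x‖ := by
        have := (fderiv ℝ (h t) x).le_opNorm (b i)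
        rwa [hbi, mul_one, Real.norm_eq_abs] at this
      calc fderiv ℝ (P t) x (b i) * fderiv ℝ (h t) x (b i)
          ≤ |fderiv ℝ (P t) x (b i) * fderiv ℝ (h t) x (b i)| := le_abs_self _
        _ = |fderiv ℝ (P t) x (b i)| * |fderiv ℝ (h t) x (b i)| := abs_mul _ _
        _ ≤ ‖fderiv ℝ (P t) x‖ * ‖fderiv ℝ (h t) x‖ :=
            mul_le_mul a1 a2 (abs_nonneg _) (norm_nonneg _)
    have h3 : ∑ i, fderiv ℝ (P t) x (b i) * fderiv ℝ (h t) x (b i) ≤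
        3 * (‖fderiv ℝ (P t) x‖ * ‖fderiv ℝ (h t) x‖) := by
      calc ∑ i, fderiv ℝ (P t) x (b i) * fderiv ℝ (h t) x (b i)
          ≤ ∑ _i, ‖fderiv ℝ (P t) x‖ * ‖fderiv ℝ (h t) x‖ := Finset.sum_le_sum fun i _ => h2 i
        _ = 3 * (‖fderiv ℝ (P t) x‖ * ‖fderiv ℝ (h t) x‖) := by
            simp [Finset.sum_const, Finset.card_univ]
    have h4 : (h t x)⁻¹ * ‖fderiv ℝ (h t) x‖ ≤ |A| * (1 / Real.sqrt (-t) + ‖x‖ / (-t)) := by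
      rw [inv_mul_le_iff₀ hhx]
      calc ‖fderiv ℝ (h t) x‖ ≤ A * (1 / Real.sqrt (-t) + ‖x‖ / (-t)) * h t x := hgrad t ht x
        _ ≤ |A| * (1 / Real.sqrt (-t) + ‖x‖ / (-t)) * h t x := by
            gcongr
            exact le_abs_self A
        _ = h t x * (|A| * (1 / Real.sqrt (-t) + ‖x‖ / (-t))) := by ring
    have h5 : 2 * (h t x)⁻¹ * ∑ i, fderiv ℝ (P t) x (b i) * fderiv ℝ (h t) x (b i) ≤
        6 * |A| * (1 / Real.sqrt (-t) + ‖x‖ / (-t)) * ‖fderiv ℝ (P t) x‖ := by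
      have hi0 : 0 ≤ 2 * (h t x)⁻¹ := by positivity
      calc 2 * (h t x)⁻¹ * ∑ i, fderiv ℝ (P t) x (b i) * fderiv ℝ (h t) x (b i)
          ≤ 2 * (h t x)⁻¹ * (3 * (‖fderiv ℝ (P t) x‖ * ‖fderiv ℝ (h t) x‖)) :=
            mul_le_mul_of_nonneg_left h3 hi0
        _ = 6 * ((h t x)⁻¹ * ‖fderiv ℝ (h t) x‖) * ‖fderiv ℝ (P t) x‖ := by ring
        _ ≤ 6 * (|A| * (1 / Real.sqrt (-t) + ‖x‖ / (-t))) * ‖fderiv ℝ (P t) x‖ := by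
            gcongr
        _ = 6 * |A| * (1 / Real.sqrt (-t) + ‖x‖ / (-t)) * ‖fderiv ℝ (P t) x‖ := by ring
    nlinarith [key, h1, h5]

/-- **The Type-I bound on the weighted quotient**: if `(−t)‖∇u(t, y)‖ ≤ K₀` on `t < 0` and
`h ≥ 1`, then `(−t)^{2−2δ} |ω|²/h² ≤ (κK₀)² (−t)^{−2δ}` with `κ = ‖curlCLM‖`
(`|ω| ≤ κ‖∇u‖`). [folklore] -/
theorem stretchCert_P_le
    {K₀ : ℝ} {u : ℝ → EuclideanSpace ℝ (Fin 3) → EuclideanSpace ℝ (Fin 3)}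
    (hK₀ : ∀ t < 0, ∀ y, (-t) * ‖fderiv ℝ (u t) y‖ ≤ K₀)
    {h : ℝ → EuclideanSpace ℝ (Fin 3) → ℝ} (hh1 : ∀ t < 0, ∀ y, 1 ≤ h t y) (δ : ℝ)
    {t : ℝ} (ht : t < 0) (x : EuclideanSpace ℝ (Fin 3)) :
    (-t) ^ (2 - 2 * δ) * (‖curl (u t) x‖ ^ 2 / h t x ^ 2) ≤
      (‖curlCLM‖ * K₀) ^ 2 * (-t) ^ (-(2 * δ)) := by
  have ht0 : 0 < -t := neg_pos.2 ht
  have hhx : 1 ≤ h t x := hh1 t ht x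
  have h1 : ‖curl (u t) x‖ ^ 2 / h t x ^ 2 ≤ ‖curl (u t) x‖ ^ 2 :=
    div_le_self (sq_nonneg _) (one_le_pow₀ hhx)
  have h2 : (-t) * ‖curl (u t) x‖ ≤ ‖curlCLM‖ * K₀ := by
    calc (-t) * ‖curl (u t) x‖ ≤ (-t) * (‖curlCLM‖ * ‖fderiv ℝ (u t) x‖) :=
          mul_le_mul_of_nonneg_left (norm_curl_le (u t) x) ht0.le
      _ = ‖curlCLM‖ * ((-t) * ‖fderiv ℝ (u t) x‖) := by ring
      _ ≤ ‖curlCLM‖ * K₀ := mul_le_mul_of_nonneg_left (hK₀ t ht x) (norm_nonneg curlCLM)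
  have h3 : ((-t) * ‖curl (u t) x‖) ^ 2 ≤ (‖curlCLM‖ * K₀) ^ 2 :=
    pow_le_pow_left₀ (mul_nonneg ht0.le (norm_nonneg _)) h2 2
  have h4 : (-t) ^ (2 - 2 * δ) = (-t) ^ (-(2 * δ)) * (-t) ^ 2 := by
    rw [show (2 - 2 * δ : ℝ) = -(2 * δ) + 2 by ring, Real.rpow_add ht0, Real.rpow_two]
  calc (-t) ^ (2 - 2 * δ) * (‖curl (u t) x‖ ^ 2 / h t x ^ 2)
      ≤ (-t) ^ (2 - 2 * δ) * ‖curl (u t) x‖ ^ 2 :=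
        mul_le_mul_of_nonneg_left h1 (Real.rpow_nonneg ht0.le _)
    _ = (-t) ^ (-(2 * δ)) * ((-t) * ‖curl (u t) x‖) ^ 2 := by rw [h4]; ring
    _ ≤ (-t) ^ (-(2 * δ)) * (‖curlCLM‖ * K₀) ^ 2 :=
        mul_le_mul_of_nonneg_left h3 (Real.rpow_nonneg ht0.le _)
    _ = (‖curlCLM‖ * K₀) ^ 2 * (-t) ^ (-(2 * δ)) := by ring

end Summit.NavierStokesRegularity.NavierStokesRegularity.Theorems

end
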